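/-
b2b-lace packet, ANALYTIC ORACLE seat gen 8 (unit `b2b-lace-oracle-g8`).  The scaling rule of the symmetrised
character `D̂^{(x)}` and the printed `x = 0` evaluation (5.13) of `U_{n,l}(0)` for even `l`.  d-generic; no
dimension sentence.
-/
import Literature.Probability.FitznerVanDerHofstad2017.SrwIntegralV
import HarnessLib

/-!
# `D̂^{(m x)}(k) = D̂^{(x)}(m k)` and `U_{n,l}(0) = (2d)⁻¹ [I_{n,l}(0) − I_{n,l}(2e₁)]` (`l` even)

CITATION HEADER (PLACEMENT v2). Part of a certified REPRODUCTION of R. Fitzner, R. van der Hofstad,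
*Generalized approach to the non-backtracking lace expansion*, Probab. Theory Related Fields 169 (2017)
1041–1119 [NoBLE17] (arXiv:1506.07969), §3.3.4 (3.34) and §5.2, as consumed by [FvdH17] (EJP 22 no. 43) Prop. 2.2:

> [NoBLE17] §5.2 (5.13) p. 1092: "For `x = 0` and even `l`, we use `D̂^{(0)}(k) = 1`, `D̂^{sin}(k) ≥ 0` and (3.27) to
> compute `U_{n,l}(0) = (1/2d) ( I_{n,l}(0) − I_{n,l}(2e₁) )`."

## What is here (every statement a kernel theorem; cites are locators)

* `DhatSym_smul`: `D̂^{(m·x)}(k) = D̂^{(x)}(m·k)` (`m ∈ ℤ`; immediate from (3.34)), hence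
  `DhatSym_single_two : D̂^{(2e_i)}(k) = D̂(2k)` (with the tree's `DhatSym_single`);
* with `Dsin_eq_half_angle` (`D̂^{sin}(k) = (1 − D̂(2k))/(2d)`, `SrwIntegralV`): the pointwise identity of integrands
  and **`srwU_zero_even`**: `U_{n,2j}(0) = (I_{n,2j}(0) − I_{n,2j}(2e_i))/(2d)` for `d ≥ 2n+1` (the integrals converge).

This is the rule by which `SRW.nb` fills `U[n,l,{0}]` for even `l` (odd `l`: `U ≤ K/d`, the tree's `srwU_le`).
-/

noncomputable section

open MeasureTheory Real Finset
open scoped BigOperators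

namespace Literature.Probability.FitznerVanDerHofstad2017

open Literature.Barriers.CriticalPhenomena
open Literature.Barriers.CriticalPhenomena.Slade2006Prop53 (P)

variable {d : ℕ}

/-! ### Scaling of `D̂^{(x)}` -/

/-- `D̂^{(m x)}(k) = D̂^{(x)}(m k)`: `Σ_j δ_j (m x_{ν_j}) k_j = Σ_j δ_j x_{ν_j} (m k_j)`.
[cite: FitznerVanDerHofstad2016NoBLE, (3.34) p. 1071] -/
theorem DhatSym_smul (m : ℤ) (x : Fin d → ℤ) (k : Fin d → ℝ) :
    DhatSym d (fun j => m * x j) k = DhatSym d x (fun j => (m : ℝ) * k j) := by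
  unfold DhatSym
  congr 1
  refine Finset.sum_congr rfl fun ν _ => Finset.sum_congr rfl fun δ _ => ?_
  congr 1
  refine Finset.sum_congr rfl fun j _ => ?_
  push_cast
  ring

/-- `2e_i = 2 · e_i` as lattice vectors. [folklore] -/
theorem single_two_eq (i : Fin d) : (Pi.single i (2 : ℤ) : Fin d → ℤ) = fun j => 2 * (Pi.single i (1 : ℤ) : Fin d → ℤ) j := by
  funext j
  by_cases h : j = i
  · subst h; simp
  · simp [Pi.single_eq_of_ne h]

/-- `D̂^{(2e_i)}(k) = D̂(2k)`. [cite: FitznerVanDerHofstad2016NoBLE, (3.34) p. 1071] -/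
theorem DhatSym_single_two (i : Fin d) (k : Fin d → ℝ) :
    DhatSym d (Pi.single i 2) k = Dhat d (fun j => 2 * k j) := by
  rw [single_two_eq i, DhatSym_smul 2 (Pi.single i 1) k, DhatSym_single]
  norm_num

/-! ### (5.13) -/

/-- The pointwise identity behind (5.13): for even `l`, at `x = 0`,
`|D̂|^l |D̂^{(0)}| D̂^{sin} Ĉⁿ = (D̂^l D̂^{(0)} Ĉⁿ − D̂^l D̂^{(2e_i)} Ĉⁿ)/(2d)`.
[cite: FitznerVanDerHofstad2016NoBLE, (5.13) p. 1092] -/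
theorem srwU_zero_even_integrand (hd : 1 ≤ d) (n j : ℕ) (i : Fin d) (k : Fin d → ℝ) :
    (|Dhat d k| ^ (2 * j) * |DhatSym d 0 k| * Dsin d k) * Chat d 1 k ^ n =
      ((Dhat d k ^ (2 * j) * DhatSym d 0 k) * Chat d 1 k ^ n
        - (Dhat d k ^ (2 * j) * DhatSym d (Pi.single i 2) k) * Chat d 1 k ^ n) / (2 * d) := by
  have habs : |Dhat d k| ^ (2 * j) = Dhat d k ^ (2 * j) := by
    rw [pow_mul, pow_mul, sq_abs]
  rw [habs, DhatSym_zero, DhatSym_single_two, Dsin_eq_half_angle hd, abs_one]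
  ring

/-- **(5.13): `U_{n,l}(0) = (2d)⁻¹ [I_{n,l}(0) − I_{n,l}(2e_i)]` for even `l = 2j`** (`d ≥ 2n + 1`).
[cite: FitznerVanDerHofstad2016NoBLE, (5.13) p. 1092] -/
theorem srwU_zero_even {n : ℕ} (hd : 2 * n + 1 ≤ d) (j : ℕ) (i : Fin d) :
    srwU d n (2 * j) 0 = (srwI d n (2 * j) 0 - srwI d n (2 * j) (Pi.single i 2)) / (2 * d) := by
  have hd1 : 1 ≤ d := by omega
  have hA := integrable_srwI_integrand hd (2 * j) (0 : Fin d → ℤ)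
  have hB := integrable_srwI_integrand hd (2 * j) (Pi.single i (2 : ℤ))
  unfold srwU srwI
  have e : ∫ k, (|Dhat d k| ^ (2 * j) * |DhatSym d 0 k| * Dsin d k) * Chat d 1 k ^ n ∂P d =
      ((∫ k, (Dhat d k ^ (2 * j) * DhatSym d 0 k) * Chat d 1 k ^ n ∂P d)
        - ∫ k, (Dhat d k ^ (2 * j) * DhatSym d (Pi.single i 2) k) * Chat d 1 k ^ n ∂P d) / (2 * d) := by
    rw [← integral_sub hA hB, ← integral_div]
    exact integral_congr_ae (ae_of_all _ fun k => srwU_zero_even_integrand hd1 n j i k)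
  rw [e]
  ring

end Literature.Probability.FitznerVanDerHofstad2017
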